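import Summits.ResolutionOfSingularities.ResolutionOfSingularities.Theorems.AffineToGlobal.Negative.PointBlowupNotRegular
import Summits.ResolutionOfSingularities.ResolutionOfSingularities.Theorems.SectionAscentFibrewiseClosedPointsOneShotCurvesDedekind

/-!
# `AffineToGlobal` — negative lemmas IV-c: the REDUCED SINGULAR LOCUS is not a one-shot centre
# (`K[X², X⁵]` is regular away from its origin, so its reduced singular locus IS the origin)

Support (negative-side) lemmas for crux `stmt-ResolutionOfSingularities-15961`
(`Summit.ResolutionOfSingularities.ResolutionOfSingularities.Theses.SectionAscent.AffineToGlobal`),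
filed by the crux disprover (cdisprove, gen 2, 2026-08-17). Negative lemmas IV-b
(`PointBlowupNotRegular.lean`) refuted "the blowing up of a singular closed point of an affine
curve is regular" with the curve `K[X², X⁵]` at its origin. This file removes the last
quantifier gap between that and the statement a gluing proof of `AffineToGlobal` would want —
"the blowing up along the REDUCED IDEAL OF THE WHOLE SINGULAR LOCUS (the vanishing ideal of the
non-regular points) is regular" — by showing that `K[X², X⁵]` is regular at every prime other than
the origin: away from `X²` it is `K[X][1/X]` inside `A[1/X²]`, an overring of the Dedekind domain
`K[X]` (tree: `OneShotCurves.isRegularLocalRing_localization_of_dedekind`, file `…OneShotCurvesDedekind.lean`).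

* `isRegularLocalRing_of_X_sq_notMem` — generic: for a domain `A`, a `K`-algebra map
  `ι : A ↪ K[X]` and generators `x₂, x₅ ↦ X², X⁵` of `A` over `K`, every prime `𝔮 ∌ x₂` has a
  regular local ring (`A_𝔮` is a local ring of `A[1/x₂] ⊇ K[X]`, `X = x₅/x₂²`).
* `adjoin_generators_cusp25_eq_top` — `K[X², X⁵]` is generated by `X², X⁵` (as elements).
* `singularLocus_cusp25` — **the non-regular primes of `K[X², X⁵]` are exactly the origin**.
* `not_reducedSingularLocus_oneShotCentre` — **refuted strengthening, every prime `p`**: it is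
  false that for every integral affine curve of finite type over a field of characteristic `p`
  the blowing up along the vanishing ideal `⨅ {𝔮 | A_𝔮 not regular}` of its singular locus (the
  reduced singular locus; `= ⊤` with regular blowing up when the curve is regular) is regular.
  Since such curves DO have one-shot centres (`OneShot p 2`, landed), the reduced singular locus —
  the unique canonical, globally gluing candidate — is not one of them in general.

No definition is declared; no declaration concludes a route decl positively.

## Sources
* J. Kollár, *Lectures on Resolution of Singularities* (2007), §1.4 (`y² = x⁵`).
* H. Matsumura, *Commutative Ring Theory*, Thm. 11.2/19.4 flavour: local rings of overrings of a
  Dedekind domain inside `C[1/a]` are regular, as proved in the tree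
  (`isRegularLocalRing_localization_of_dedekind`).
-/

noncomputable section

set_option linter.dupNamespace false -- mandated namespace of this single-conjunct summit

open CategoryTheory AlgebraicGeometry Polynomial
open Literature.AlgebraicGeometry.Resolution
open Summit.ResolutionOfSingularities.ResolutionOfSingularities.Theses.SectionAscent (AffineToGlobal)

namespace Summit.ResolutionOfSingularities.ResolutionOfSingularities.Theorems.AffineToGlobal.Negative

section Regular

variable (K : Type) [Field K]

/-- **Away from `x₂` a monomial-curve algebra is regular.** Let `A` be a domain with an injective
`K`-algebra map `ι : A → K[X]`, generated over `K` by `x₂, x₅` with `ι x₂ = X²`, `ι x₅ = X⁵`.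
Then every prime `𝔮 ∌ x₂` has a regular local ring: `A_𝔮` is a local ring of the domain
`A[1/x₂]`, which receives `K[X]` injectively by `X ↦ x₅/x₂²` (`(x₅/x₂²)² = x₂`,
`(x₅/x₂²)⁵ = x₅`) and lies inside `K[X][1/X²]`; local rings of such overrings of a Dedekind
domain are regular (`isRegularLocalRing_localization_of_dedekind`). [cite: Matsumura1987, Thm. 11.2] -/
theorem isRegularLocalRing_of_X_sq_notMem {A : Type} [CommRing A] [IsDomain A] [Algebra K A]
    (ι : A →ₐ[K] K[X]) (hι : Function.Injective ι)
    (x₂ x₅ : A) (hx₂ : ι x₂ = X ^ 2) (hx₅ : ι x₅ = X ^ 5)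
    (hgen : Algebra.adjoin K ({x₂, x₅} : Set A) = ⊤)
    (𝔮 : PrimeSpectrum A) (h𝔮 : x₂ ∉ 𝔮.asIdeal) :
    IsRegularLocalRing (Localization.AtPrime 𝔮.asIdeal) := by
  have hx₂0 : x₂ ≠ 0 := by
    intro h
    have h' : (X ^ 2 : K[X]) = 0 := by rw [← hx₂, h, map_zero]
    exact pow_ne_zero 2 Polynomial.X_ne_zero h'
  haveI : IsDomain (Localization.Away x₂) :=
    IsLocalization.isDomain_localization (powers_le_nonZeroDivisors_of_noZeroDivisors hx₂0)
  -- relations in `A`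
  have r1 : x₅ * x₅ = x₂ ^ 5 := hι (by rw [map_mul, map_pow, hx₂, hx₅]; ring)
  have r2 : x₅ ^ 5 = x₅ * x₂ ^ 10 := hι (by rw [map_mul, map_pow, map_pow, hx₂, hx₅]; ring)
  have hinv : algebraMap A (Localization.Away x₂) x₂ * IsLocalization.Away.invSelf x₂ = 1 :=
    IsLocalization.Away.mul_invSelf x₂
  -- `u = x₅/x₂²`, with `u² = x₂`, `u⁵ = x₅`
  obtain ⟨u, hudef⟩ : ∃ u : Localization.Away x₂,
      u = algebraMap A _ x₅ * IsLocalization.Away.invSelf x₂ ^ 2 := ⟨_, rfl⟩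
  have hu2 : u ^ 2 = algebraMap A _ x₂ := by
    rw [hudef]
    calc (algebraMap A (Localization.Away x₂) x₅ * IsLocalization.Away.invSelf x₂ ^ 2) ^ 2
        = algebraMap A _ (x₅ * x₅) * IsLocalization.Away.invSelf x₂ ^ 4 := by rw [map_mul]; ring
      _ = algebraMap A _ x₂ * (algebraMap A _ x₂ * IsLocalization.Away.invSelf x₂) ^ 4 := by
          rw [r1, map_pow]; ring
      _ = algebraMap A _ x₂ := by rw [hinv, one_pow, mul_one]
  have hu5 : u ^ 5 = algebraMap A _ x₅ := by
    rw [hudef]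
    calc (algebraMap A (Localization.Away x₂) x₅ * IsLocalization.Away.invSelf x₂ ^ 2) ^ 5
        = algebraMap A _ (x₅ ^ 5) * IsLocalization.Away.invSelf x₂ ^ 10 := by rw [map_pow]; ring
      _ = algebraMap A _ x₅ * (algebraMap A _ x₂ * IsLocalization.Away.invSelf x₂) ^ 10 := by
          rw [r2, map_mul, map_pow]; ring
      _ = algebraMap A _ x₅ := by rw [hinv, one_pow, mul_one]
  -- `φ : K[X] → A[1/x₂]`, `X ↦ u`
  obtain ⟨φ, hφdef⟩ : ∃ φ : K[X] →+* Localization.Away x₂,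
      φ = Polynomial.eval₂RingHom (algebraMap K (Localization.Away x₂)) u := ⟨_, rfl⟩
  have hφX : φ X = u := by rw [hφdef]; simp
  have hφC : ∀ c : K, φ (C c) = algebraMap K _ c := fun c => by rw [hφdef]; simp
  have hφ2 : φ (X ^ 2) = algebraMap A _ x₂ := by rw [map_pow, hφX, hu2]
  -- `φ ∘ ι` is the structure map on all of `A`
  have hφι : ∀ a : A, φ (ι a) = algebraMap A _ a := by
    intro a
    have ha : a ∈ Algebra.adjoin K ({x₂, x₅} : Set A) := by rw [hgen]; exact Algebra.mem_top
    induction ha using Algebra.adjoin_induction with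
    | mem x hx =>
      simp only [Set.mem_insert_iff, Set.mem_singleton_iff] at hx
      rcases hx with rfl | rfl
      · rw [hx₂, map_pow, hφX, hu2]
      · rw [hx₅, map_pow, hφX, hu5]
    | algebraMap c =>
      rw [AlgHom.commutes]
      change φ (C c) = _
      rw [hφC, IsScalarTower.algebraMap_apply K A]
    | add x y _ _ hx hy => rw [map_add, map_add, hx, hy, map_add]
    | mul x y _ _ hx hy => rw [map_mul, map_mul, hx, hy, map_mul]
  -- `φ` is injective: follow it by `A[1/x₂] → K[X][1/X²]`
  have hunit2 : IsUnit (((algebraMap K[X] (Localization.Away ((X : K[X]) ^ 2))).comp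
      ι.toRingHom) x₂) := by
    change IsUnit (algebraMap K[X] (Localization.Away ((X : K[X]) ^ 2)) (ι x₂))
    rw [hx₂]
    exact IsLocalization.Away.algebraMap_isUnit _
  obtain ⟨θ, hθdef⟩ : ∃ θ : Localization.Away x₂ →+* Localization.Away ((X : K[X]) ^ 2),
      θ = IsLocalization.Away.lift x₂ hunit2 := ⟨_, rfl⟩
  have hθA : ∀ a, θ (algebraMap A _ a) = algebraMap K[X] _ (ι a) := fun a => by
    rw [hθdef, IsLocalization.Away.lift_eq]; rfl
  have hθinv0 : θ (IsLocalization.Away.invSelf x₂) * algebraMap K[X] _ (ι x₂) = 1 := by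
    rw [← hθA, ← map_mul, mul_comm, hinv, map_one]
  have hθinv : θ (IsLocalization.Away.invSelf x₂) * algebraMap K[X] _ (X ^ 2) = 1 := by
    simpa only [hx₂] using hθinv0
  have hU : IsUnit (algebraMap K[X] (Localization.Away ((X : K[X]) ^ 2)) (X ^ 2)) :=
    IsLocalization.Away.algebraMap_isUnit _
  have hθu : θ u = algebraMap K[X] _ X := by
    apply (hU.pow 2).mul_left_injective
    dsimp only
    rw [hudef, map_mul, map_pow, hθA, hx₅]
    calc algebraMap K[X] (Localization.Away ((X : K[X]) ^ 2)) (X ^ 5) *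
          θ (IsLocalization.Away.invSelf x₂) ^ 2 * algebraMap K[X] _ (X ^ 2) ^ 2
        = algebraMap K[X] _ (X ^ 5) *
            (θ (IsLocalization.Away.invSelf x₂) * algebraMap K[X] _ (X ^ 2)) ^ 2 := by ring
      _ = algebraMap K[X] _ (X ^ 5) := by rw [hθinv, one_pow, mul_one]
      _ = algebraMap K[X] _ X * algebraMap K[X] _ (X ^ 2) ^ 2 := by
          rw [← map_pow, ← map_mul]; congr 1; ring
  have hθφ : θ.comp φ = algebraMap K[X] _ := by
    apply Polynomial.ringHom_ext
    · intro c
      rw [RingHom.comp_apply, hφC, IsScalarTower.algebraMap_apply K A (Localization.Away x₂), hθA,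
        AlgHom.commutes]
      rfl
    · rw [RingHom.comp_apply, hφX, hθu]
  have hφinj : Function.Injective φ := by
    intro f g hfg
    have h := congrArg θ hfg
    rw [← RingHom.comp_apply, ← RingHom.comp_apply, hθφ] at h
    exact IsLocalization.injective (M := Submonoid.powers ((X : K[X]) ^ 2)) (Localization.Away _)
      (powers_le_nonZeroDivisors_of_noZeroDivisors (pow_ne_zero 2 X_ne_zero)) h
  -- `A[1/x₂] ⊆ K[X][1/X²]` through `φ`
  have hB : ∀ z : Localization.Away x₂, ∃ (n : ℕ) (x : K[X]), φ (X ^ 2) ^ n * z = φ x := by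
    intro z
    obtain ⟨⟨a, s, k, rfl⟩, hz⟩ := IsLocalization.surj (Submonoid.powers x₂) z
    refine ⟨k, ι a, ?_⟩
    rw [hφ2, hφι, ← map_pow, mul_comm]
    exact hz
  -- the prime of `A[1/x₂]` over `𝔮`
  have hd : Disjoint (Submonoid.powers x₂ : Set A) 𝔮.asIdeal := by
    rw [Set.disjoint_left]
    rintro _ ⟨k, rfl⟩ hk
    exact h𝔮 (𝔮.isPrime.mem_of_pow_mem k hk)
  haveI hQ : (Ideal.map (algebraMap A (Localization.Away x₂)) 𝔮.asIdeal).IsPrime :=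
    IsLocalization.isPrime_of_isPrime_disjoint (Submonoid.powers x₂) _ _ 𝔮.isPrime hd
  have hreg := _root_.Summit.ResolutionOfSingularities.ResolutionOfSingularities.Theorems.SectionAscent.OneShotCurves.isRegularLocalRing_localization_of_dedekind
    φ hφinj (pow_ne_zero 2 X_ne_zero) hB (Ideal.map (algebraMap A (Localization.Away x₂)) 𝔮.asIdeal)
  -- transfer to `A_𝔮`
  have hunder : (Ideal.map (algebraMap A (Localization.Away x₂)) 𝔮.asIdeal).comap
      (algebraMap A (Localization.Away x₂)) = 𝔮.asIdeal :=
    IsLocalization.under_map_of_isPrime_disjoint (Submonoid.powers x₂) (Localization.Away x₂)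
      𝔮.isPrime hd
  haveI := hreg
  have h1 : IsRegularLocalRing (Localization.AtPrime
      ((Ideal.map (algebraMap A (Localization.Away x₂)) 𝔮.asIdeal).comap
        (algebraMap A (Localization.Away x₂)))) :=
    IsRegularLocalRing.of_ringEquiv
      (IsLocalization.localizationLocalizationAtPrimeIsoLocalization (Submonoid.powers x₂)
        (Ideal.map (algebraMap A (Localization.Away x₂)) 𝔮.asIdeal)).symm.toRingEquiv
  -- transport along the equality of primes `comap (map 𝔮) = 𝔮`
  have key : ∀ (I : Ideal A) [I.IsPrime], I = 𝔮.asIdeal →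
      IsRegularLocalRing (Localization.AtPrime I) → IsRegularLocalRing (Localization.AtPrime 𝔮.asIdeal) := by
    intro I _ h hI
    subst h
    exact hI
  exact key _ hunder h1

/-- `K[X², X⁵]` is generated, over `K`, by its elements `X²` and `X⁵`. [folklore] -/
theorem adjoin_generators_cusp25_eq_top :
    Algebra.adjoin K ({⟨X ^ 2, Algebra.subset_adjoin (by simp)⟩, ⟨X ^ 5, Algebra.subset_adjoin (by simp)⟩} :
      Set ↥(Algebra.adjoin K ({X ^ 2, X ^ 5} : Set K[X]))) = ⊤ := by
  apply eq_top_iff.mpr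
  rintro ⟨f, hf⟩ -
  induction hf using Algebra.adjoin_induction with
  | mem x hx =>
    simp only [Set.mem_insert_iff, Set.mem_singleton_iff] at hx
    rcases hx with rfl | rfl
    · exact Algebra.subset_adjoin (Set.mem_insert _ _)
    · exact Algebra.subset_adjoin (Set.mem_insert_of_mem _ rfl)
  | algebraMap c =>
    have : (⟨algebraMap K K[X] c, Subalgebra.algebraMap_mem _ c⟩ :
        ↥(Algebra.adjoin K ({X ^ 2, X ^ 5} : Set K[X]))) = algebraMap K _ c := Subtype.ext rfl
    rw [this]
    exact Subalgebra.algebraMap_mem _ c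
  | add x y hx hy ihx ihy =>
    have : (⟨x + y, add_mem hx hy⟩ : ↥(Algebra.adjoin K ({X ^ 2, X ^ 5} : Set K[X]))) =
        ⟨x, hx⟩ + ⟨y, hy⟩ := rfl
    rw [this]
    exact add_mem ihx ihy
  | mul x y hx hy ihx ihy =>
    have : (⟨x * y, mul_mem hx hy⟩ : ↥(Algebra.adjoin K ({X ^ 2, X ^ 5} : Set K[X]))) =
        ⟨x, hx⟩ * ⟨y, hy⟩ := rfl
    rw [this]
    exact mul_mem ihx ihy

/-- **The singular locus of `K[X², X⁵]` is exactly the origin**: a prime has a non-regular local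
ring iff it consists of the elements with vanishing constant term. [folklore] -/
theorem singularLocus_cusp25 (𝔭 : PrimeSpectrum ↥(Algebra.adjoin K ({X ^ 2, X ^ 5} : Set K[X])))
    (h𝔭 : ∀ a : ↥(Algebra.adjoin K ({X ^ 2, X ^ 5} : Set K[X])),
      a ∈ 𝔭.asIdeal ↔ (a : K[X]).coeff 0 = 0)
    (𝔮 : PrimeSpectrum ↥(Algebra.adjoin K ({X ^ 2, X ^ 5} : Set K[X]))) :
    ¬ IsRegularLocalRing (Localization.AtPrime 𝔮.asIdeal) ↔ 𝔮 = 𝔭 := by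
  constructor
  · intro hsing
    -- `X² ∈ 𝔮` (else `𝔮` is regular), hence `X⁵ ∈ 𝔮`, hence `𝔭 ≤ 𝔮`, hence equal
    have h2 : (⟨X ^ 2, Algebra.subset_adjoin (by simp)⟩ :
        ↥(Algebra.adjoin K ({X ^ 2, X ^ 5} : Set K[X]))) ∈ 𝔮.asIdeal := by
      by_contra h2
      exact hsing (isRegularLocalRing_of_X_sq_notMem K
        (Algebra.adjoin K ({X ^ 2, X ^ 5} : Set K[X])).val Subtype.val_injective _ _ rfl rfl
        (adjoin_generators_cusp25_eq_top K) 𝔮 h2)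
    have h5 : (⟨X ^ 5, Algebra.subset_adjoin (by simp)⟩ :
        ↥(Algebra.adjoin K ({X ^ 2, X ^ 5} : Set K[X]))) ∈ 𝔮.asIdeal := by
      apply 𝔮.isPrime.mem_of_pow_mem 2
      have : (⟨X ^ 5, Algebra.subset_adjoin (by simp)⟩ :
            ↥(Algebra.adjoin K ({X ^ 2, X ^ 5} : Set K[X]))) ^ 2 =
          (⟨X ^ 2, Algebra.subset_adjoin (by simp)⟩ :
            ↥(Algebra.adjoin K ({X ^ 2, X ^ 5} : Set K[X]))) ^ 5 :=
        Subtype.ext (by simp only [SubmonoidClass.coe_pow]; ring)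
      rw [this]
      exact Ideal.pow_mem_of_mem _ h2 5 (by norm_num)
    have hle : 𝔭.asIdeal ≤ 𝔮.asIdeal := by
      intro a ha
      obtain ⟨b, c, hbc⟩ := Ideal.mem_span_pair.mp
        ((mem_span_iff_coeff_zero_eq_zero K a).mpr ((h𝔭 a).mp ha))
      rw [← hbc]
      exact add_mem (Ideal.mul_mem_left _ _ h2) (Ideal.mul_mem_left _ _ h5)
    -- `𝔭` is maximal: its residue ring is the field `K`
    have hmax : 𝔭.asIdeal.IsMaximal := by
      apply Ideal.Quotient.maximal_of_isField
      refine ⟨⟨0, 1, ?_⟩, fun x y => mul_comm x y, ?_⟩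
      · intro h01
        have h1 : (1 : ↥(Algebra.adjoin K ({X ^ 2, X ^ 5} : Set K[X]))) ∈ 𝔭.asIdeal :=
          Ideal.Quotient.eq_zero_iff_mem.mp h01.symm
        exact 𝔭.isPrime.ne_top ((Ideal.eq_top_iff_one _).mpr h1)
      · intro q hq
        obtain ⟨a, rfl⟩ := Ideal.Quotient.mk_surjective q
        have ha : a ∉ 𝔭.asIdeal := fun h => hq (Ideal.Quotient.eq_zero_iff_mem.mpr h)
        have ha0 : (a : K[X]).coeff 0 ≠ 0 := fun h => ha ((h𝔭 a).mpr h)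
        refine ⟨Ideal.Quotient.mk _ (algebraMap K _ ((a : K[X]).coeff 0)⁻¹), ?_⟩
        rw [← map_mul, ← (Ideal.Quotient.mk 𝔭.asIdeal).map_one, Ideal.Quotient.eq, h𝔭]
        simp [Subalgebra.coe_algebraMap, ha0]
    exact PrimeSpectrum.ext (hmax.eq_of_le 𝔮.isPrime.ne_top hle).symm
  · rintro rfl
    exact not_isRegularLocalRing_origin_of_coeff_one_eq_zero' K
      (Algebra.adjoin K ({X ^ 2, X ^ 5} : Set K[X])).val.toRingHom Subtype.val_injective
      (fun a => (coeff_one_three_eq_zero_of_mem K a.2).1)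
      ⟨X ^ 2, Algebra.subset_adjoin (by simp)⟩ ⟨X ^ 5, Algebra.subset_adjoin (by simp)⟩ 1
      rfl rfl 𝔮 h𝔭

/-- **The reduced singular locus of `K[X², X⁵]` is the origin, and blowing it up does not give a
regular scheme.** [folklore] -/
theorem not_isRegular_affineBlowup_reducedSingularLocus_cusp25 :
    ¬ Scheme.IsRegular (affineBlowup
      (⨅ 𝔮 ∈ {𝔮 : PrimeSpectrum ↥(Algebra.adjoin K ({X ^ 2, X ^ 5} : Set K[X])) |
          ¬ IsRegularLocalRing (Localization.AtPrime 𝔮.asIdeal)}, 𝔮.asIdeal)) := by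
  obtain ⟨𝔭, h𝔭⟩ := exists_origin K (Algebra.adjoin K ({X ^ 2, X ^ 5} : Set K[X])).val.toRingHom
  have h𝔭' : ∀ a : ↥(Algebra.adjoin K ({X ^ 2, X ^ 5} : Set K[X])),
      a ∈ 𝔭.asIdeal ↔ (a : K[X]).coeff 0 = 0 := h𝔭
  have hset : {𝔮 : PrimeSpectrum ↥(Algebra.adjoin K ({X ^ 2, X ^ 5} : Set K[X])) |
      ¬ IsRegularLocalRing (Localization.AtPrime 𝔮.asIdeal)} = {𝔭} := by
    ext 𝔮
    rw [Set.mem_setOf_eq, Set.mem_singleton_iff]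
    exact singularLocus_cusp25 K 𝔭 h𝔭' 𝔮
  rw [hset]
  simp only [Set.mem_singleton_iff, iInf_iInf_eq_left]
  have hgen : ∀ m ∈ 𝔭.asIdeal, ∃ b c : ↥(Algebra.adjoin K ({X ^ 2, X ^ 5} : Set K[X])),
      b * ⟨X ^ 2, Algebra.subset_adjoin (by simp)⟩ + c * ⟨X ^ 5, Algebra.subset_adjoin (by simp)⟩ = m :=
    fun m hm => Ideal.mem_span_pair.mp ((mem_span_iff_coeff_zero_eq_zero K m).mpr ((h𝔭' m).mp hm))
  exact not_isRegular_affineBlowup_of_coeff K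
    (Algebra.adjoin K ({X ^ 2, X ^ 5} : Set K[X])).val.toRingHom Subtype.val_injective
    (fun a => coeff_one_three_eq_zero_of_mem K a.2) _ _ rfl rfl 𝔭.asIdeal h𝔭' hgen

end Regular

/-! ## The refuted strengthening, every prime -/

/-- **Refuted natural strengthening of the hypothesis `OneShot`, every prime `p`: "the reduced
singular locus of an integral affine curve of finite type over a field of characteristic `p` is a
one-shot centre"** — i.e. the blowing up along the vanishing ideal `⨅ {𝔮 | A_𝔮 not regular}`
(`= ⊤`, identity blowing up, on a regular curve) is regular — is FALSE: witness `(ZMod p)[X², X⁵]`,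
whose singular locus is the origin and whose blowing up there has the cusp `K[X², X³]` as a chart
(negative lemmas IV-a/b). The curve does have one-shot centres (`OneShot p 2`, landed — e.g. the
conductor), all of them therefore non-reduced. [folklore] -/
theorem not_reducedSingularLocus_oneShotCentre (p : ℕ) (hp : p.Prime) :
    ¬ ∀ (K : Type) [Field K] [CharP K p] (A : Type) [CommRing A] [IsDomain A] [Algebra K A]
        [Algebra.FiniteType K A], ringKrullDim A < ((2 : ℕ) : WithBot ℕ∞) →
        Scheme.IsRegular (affineBlowup
          (⨅ 𝔮 ∈ {𝔮 : PrimeSpectrum A | ¬ IsRegularLocalRing (Localization.AtPrime 𝔮.asIdeal)},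
            𝔮.asIdeal)) := by
  intro h
  haveI : Fact p.Prime := ⟨hp⟩
  haveI := finiteType_cusp25 (ZMod p)
  exact not_isRegular_affineBlowup_reducedSingularLocus_cusp25 (ZMod p)
    (h (ZMod p) _ (ringKrullDim_cusp25_lt_two (ZMod p)))

end Summit.ResolutionOfSingularities.ResolutionOfSingularities.Theorems.AffineToGlobal.Negative

end
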